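import Literature.NumberTheory.LFunctions.StarkNoQuadraticSubfieldProofs
import HarnessLib

/-!
# Crux `DegreeOnePrimesEscape` (stmt-QuantumAdvantage-11543), stub `stub_starkResidue`

Line `dedekind-s3-collision`, stub `stub_starkResidue` (the Stark residue): in every degree `n ≠ 3`
there is `c = c(n) > 0` such that for every number field `K` of degree `n` without quadratic
subfield, `ζ_K(σ) ≠ 0` for `1 − c/log|d_K| ≤ σ < 1`.

This is the degree-`n` slice of the tree's named fact
`Stark1974_dedekindZeta_ne_zero_of_noQuadraticSubfield` (namespace
`Literature.NumberTheory.LFunctions.NumberField`; Stark 1974, Thm. 3 / Murty–Murty Ch. 2,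
Cor. 6.2), PROVED in
`Literature/NumberTheory/LFunctions/StarkNoQuadraticSubfieldProofs.lean`
(`Stark1974_dedekindZeta_ne_zero_of_noQuadraticSubfield_holds`), with the explicit constant
`c = 1/(4·n!)` (the hypothesis `n ≠ 3` is not used: the fact covers every degree).
-/

noncomputable section

open scoped NumberField nonZeroDivisors
open Literature.NumberTheory.LFunctions Literature.NumberTheory.LFunctions.NumberField

namespace Summit.QuantumAdvantage.QuantumAdvantage.Theorems.DegreeOnePrimesEscape

/-- **Stub `stub_starkResidue`** (line `dedekind-s3-collision` of crux `DegreeOnePrimesEscape`):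
for every degree `n ≠ 3` there is `c > 0` (namely `c = 1/(4·n!)`) such that every number field `K`
of degree `n` with no quadratic subfield has `ζ_K(σ) ≠ 0` for `1 − c/log|d_K| ≤ σ < 1` — from
Stark's theorem `Stark1974_dedekindZeta_ne_zero_of_noQuadraticSubfield_holds`. -/
theorem stub_starkResidue :
    ∀ n : ℕ, n ≠ 3 →
      ∃ c : ℝ, 0 < c ∧ ∀ (K : Type) [Field K] [NumberField K], Module.finrank ℚ K = n →
        (∀ F : IntermediateField ℚ K, Module.finrank ℚ F ≠ 2) →
        ∀ σ : ℝ, 1 - c / Real.log ((NumberField.discr K).natAbs : ℝ) ≤ σ → σ < 1 →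
          dedekindZetaCont K σ ≠ 0 := by
  intro n _
  refine ⟨1 / (4 * (n.factorial : ℝ)), by positivity, fun K _ _ hK hnq σ hσ hσ1 => ?_⟩
  refine Stark1974_dedekindZeta_ne_zero_of_noQuadraticSubfield_holds K hnq σ ?_ hσ1
  subst hK
  have h : 1 / (4 * ((Module.finrank ℚ K).factorial : ℝ)) /
        Real.log ((NumberField.discr K).natAbs : ℝ) =
      1 / (4 * ((Module.finrank ℚ K).factorial : ℝ) *
        Real.log ((NumberField.discr K).natAbs : ℝ)) := by
    rw [div_div]
  linarith [h]

end Summit.QuantumAdvantage.QuantumAdvantage.Theorems.DegreeOnePrimesEscape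

end
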